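import Literature.Geometry.Riemannian.RicciFlowCurvatureDoubling
import Literature.Geometry.Lorentzian.CoordCurvatureDerivatives
import Literature.Geometry.Lorentzian.CoordTensorCovariance
import HarnessLib

/-!
# `|∇^k Rm|²` of a family of metrics on a manifold (Topping 2006, §3.3)
(topic `Geometry/Riemannian`)

The global scalar functions `U_k(t, z) = |∇^k Rm(g(t))|²(z)` of a time-dependent family of
Riemannian metrics on a boundaryless manifold, defined through the rank-generic component
calculus of `Lorentzian/CoordTensorCalculus.lean` … `CoordTensorCovariance.lean` in the preferred
chart at each point (`curvDerivNormSq`), and their basic properties along a Ricci flow: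

* `transSource`, `isCoordChangeOn_trans`, `chartRep_eq_pullMetric_trans` — the change of
  preferred charts is a coordinate change in the sense of `MetricCoord.IsCoordChangeOn`, and the
  chart representatives of the family are related by pull-back along it;
* `curvDerivNormSq_eq_chart` — **chart independence**: `U_k` may be computed in any preferred
  chart containing the point (covariance of `∇^k Rm`, `tnormSq_curvD_pullMetric`);
* `curvDerivNormSq_zero_eq` — `U_0 = |Rm|²` (`curvNormSqWith`);
* `IsRicciFlow.contMDiffOn_curvDerivNormSq` — joint smoothness of `(z, t) ↦ U_k(t, z)` on
  `M × [0, τ]`;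
* **`IsRicciFlow.derivWithin_curvDerivNormSq_le`** — the evolution inequality (Topping 2006,
  (3.3.4) for all `k`; Hamilton 1982, Thm. 13.4 ff.): on a closed manifold there is `C` with
  `∂_t U_k ≤ Δ_{g(t)} U_k − 2 U_{k+1} + C (Σ_{p ≤ k} √U_p √U_{k−p}) √U_k + C √U_0 U_k`
  at every `(t, z)`.

## References

* P. Topping, *Lectures on the Ricci flow*, LMS Lecture Note Series 325, CUP 2006, §2.5
  (Prop. 2.5.1), §3.3 (Thm. 3.3.1, (3.3.3)–(3.3.4)), §5.3 (pp. 46–48). [Topping2006]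
* R. S. Hamilton, *Three-manifolds with positive Ricci curvature*, J. Differential Geom. 17
  (1982), §13. [Hamilton1982]
-/

noncomputable section

set_option maxSynthPendingDepth 3

open Bundle Set Filter Module Function TopologicalSpace
open scoped Manifold ContDiff Topology

namespace Literature.Geometry.Riemannian

open Lorentzian Lorentzian.PseudoRiemannianMetric MetricCoord

/-! ### The change of preferred charts as a coordinate change -/

section Transition

variable {E : Type*} [NormedAddCommGroup E] [NormedSpace ℝ E]
  {H : Type*} [TopologicalSpace H] {I : ModelWithCorners ℝ E H} [I.Boundaryless]
  {M : Type*} [TopologicalSpace M] [ChartedSpace H M] [IsManifold I ∞ M]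

variable (I) in
/-- The domain of the transition map `extChartAt I z₀ ∘ (extChartAt I z).symm` between the
preferred charts at `z` and `z₀`. [folklore] -/
def transSource (z z₀ : M) : Set E :=
  (extChartAt I z).target ∩ (extChartAt I z).symm ⁻¹' (extChartAt I z₀).source

omit [I.Boundaryless] [IsManifold I ∞ M] in
/-- `transSource` is the source of the composite partial equivalence. [folklore] -/
theorem transSource_eq (z z₀ : M) :
    transSource I z z₀ = ((extChartAt I z).symm ≫ extChartAt I z₀).source := by
  rw [PartialEquiv.trans_source, PartialEquiv.symm_source]
  rfl

omit [IsManifold I ∞ M] in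
/-- `transSource` is open. [folklore] -/
theorem isOpen_transSource (z z₀ : M) : IsOpen (transSource I z z₀) :=
  (continuousOn_extChartAt_symm z).isOpen_inter_preimage (isOpen_extChartAt_target z)
    (isOpen_extChartAt_source z₀)

omit [I.Boundaryless] [IsManifold I ∞ M] in
/-- The chart image of a point of both chart sources lies in `transSource`. [folklore] -/
theorem extChartAt_mem_transSource {z z₀ x : M} (hx₁ : x ∈ (extChartAt I z).source)
    (hx₂ : x ∈ (extChartAt I z₀).source) : extChartAt I z x ∈ transSource I z z₀ :=
  ⟨(extChartAt I z).map_source hx₁, by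
    show (extChartAt I z).symm (extChartAt I z x) ∈ (extChartAt I z₀).source
    rwa [(extChartAt I z).left_inv hx₁]⟩

/-- The transition map is differentiable with derivative `tangentCoordChange`. [folklore] -/
theorem hasFDerivAt_trans {z z₀ : M} {y : E} (hy : y ∈ transSource I z z₀) :
    HasFDerivAt (extChartAt I z₀ ∘ (extChartAt I z).symm)
      (tangentCoordChange I z z₀ ((extChartAt I z).symm y)) y := by
  have hx₁ : (extChartAt I z).symm y ∈ (extChartAt I z).source := (extChartAt I z).map_target hy.1
  have h := hasFDerivWithinAt_tangentCoordChange (I := I) (x := z) (y := z₀) ⟨hx₁, hy.2⟩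
  rw [ModelWithCorners.Boundaryless.range_eq_univ, hasFDerivWithinAt_univ,
    (extChartAt I z).right_inv hy.1] at h
  exact h

omit [I.Boundaryless] in
/-- `tangentCoordChange` between two preferred charts is invertible on the common source.
[folklore] -/
theorem isInvertible_tangentCoordChange {z z₀ x : M} (hx₁ : x ∈ (extChartAt I z).source)
    (hx₂ : x ∈ (extChartAt I z₀).source) : (tangentCoordChange I z z₀ x).IsInvertible := by
  refine ⟨ContinuousLinearEquiv.equivOfInverse (tangentCoordChange I z z₀ x)
    (tangentCoordChange I z₀ z x) (fun v ↦ ?_) (fun v ↦ ?_), rfl⟩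
  · exact (tangentCoordChange_comp ⟨⟨hx₁, hx₂⟩, hx₁⟩).trans (tangentCoordChange_self hx₁)
  · exact (tangentCoordChange_comp ⟨⟨hx₂, hx₁⟩, hx₂⟩).trans (tangentCoordChange_self hx₂)

/-- **The change of preferred charts is a coordinate change** (`MetricCoord.IsCoordChangeOn`):
open domain, `C^∞`, into the target chart, with invertible derivative. [folklore] -/
theorem isCoordChangeOn_trans (z z₀ : M) :
    IsCoordChangeOn (extChartAt I z₀ ∘ (extChartAt I z).symm) (transSource I z z₀)
      (extChartAt I z₀).target where
  isOpen := isOpen_transSource z z₀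
  contDiffOn := by rw [transSource_eq]; exact contDiffOn_ext_coord_change z₀ z
  mapsTo := fun _ hy ↦ (extChartAt I z₀).map_source hy.2
  isInvertible := fun y hy ↦ by
    rw [(hasFDerivAt_trans hy).fderiv]
    exact isInvertible_tangentCoordChange ((extChartAt I z).map_target hy.1) hy.2

/-- **The chart representatives of a family of metrics in two preferred charts are related by
pull-back along the transition map**: on `transSource I z z₀`,
`chartRep I g z t = τ^*(chartRep I g z₀ t)`, `τ = extChartAt I z₀ ∘ (extChartAt I z).symm`
(the cocycle property of `tangentCoordChange`). [folklore] -/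
theorem chartRep_eq_pullMetric_trans (g : ℝ → PseudoRiemannianMetric I ∞ E (TangentSpace I : M → Type _))
    (t : ℝ) {z z₀ : M} {y : E} (hy : y ∈ transSource I z z₀) :
    chartRep I g z t y = pullMetric (chartRep I g z₀ t) (extChartAt I z₀ ∘ (extChartAt I z).symm) y := by
  set x := (extChartAt I z).symm y with hxdef
  have hx₁ : x ∈ (extChartAt I z).source := (extChartAt I z).map_target hy.1
  have hx₂ : x ∈ (extChartAt I z₀).source := hy.2
  have hx₁' : x ∈ (chartAt H z).source := by rwa [← extChartAt_source I]
  have hx₂' : x ∈ (chartAt H z₀).source := by rwa [← extChartAt_source I]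
  have hD : fderiv ℝ (extChartAt I z₀ ∘ (extChartAt I z).symm) y = tangentCoordChange I z z₀ x :=
    (hasFDerivAt_trans hy).fderiv
  have hτ : (extChartAt I z₀).symm ((extChartAt I z₀ ∘ (extChartAt I z).symm) y) = x :=
    (extChartAt I z₀).left_inv hx₂
  have hmem : x ∈ (extChartAt I z).source ∩ (extChartAt I z₀).source ∩ (extChartAt I x).source :=
    ⟨⟨hx₁, hx₂⟩, mem_extChartAt_source x⟩
  ext v w
  rw [pullMetric_apply, hD]
  simp only [chartRep, gramOpFamily, ContinuousLinearMap.bilinearComp_apply]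
  rw [hτ, ← hxdef, TangentBundle.symmL_trivializationAt_eq_core hx₁',
    TangentBundle.symmL_trivializationAt_eq_core hx₂']
  change ((g t).val x) (tangentCoordChange I z x x v) (tangentCoordChange I z x x w) =
    ((g t).val x) (tangentCoordChange I z₀ x x (tangentCoordChange I z z₀ x v))
      (tangentCoordChange I z₀ x x (tangentCoordChange I z z₀ x w))
  rw [tangentCoordChange_comp hmem, tangentCoordChange_comp hmem]

end Transition

/-! ### `U_k = |∇^k Rm|²` on the manifold -/

section Global

variable {E : Type*} [NormedAddCommGroup E] [NormedSpace ℝ E] [FiniteDimensional ℝ E]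
  [CompleteSpace E] {H : Type*} [TopologicalSpace H] {I : ModelWithCorners ℝ E H} [I.Boundaryless]
  {M : Type*} [TopologicalSpace M] [ChartedSpace H M] [IsManifold I ∞ M]

variable (I) in
/-- **`U_k(t, z) = |∇^k Rm(g(t))|²(z)`** for a time-dependent family of metrics `g` on `M`: the
squared norm `tnormSq` of the `k`-th covariant derivative `curvD … k` of the curvature tensor of
the chart representative `chartRep I g z` (components in the preferred chart at `z`, standard
basis `finBasis` of the model space), evaluated at the chart image of `z`. Independent of the
chart (`curvDerivNormSq_eq_chart`). [cite: Topping2006, §3.3, Thm. 3.3.1] -/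
def curvDerivNormSq (g : ℝ → PseudoRiemannianMetric I ∞ E (TangentSpace I : M → Type _)) (k : ℕ)
    (t : ℝ) (z : M) : ℝ :=
  tnormSq (chartRep I g z t) (finBasis ℝ E) (curvD (chartRep I g z) (finBasis ℝ E) k t) (extChartAt I z z)

variable {g : ℝ → PseudoRiemannianMetric I ∞ E (TangentSpace I : M → Type _)}
  {cov : ℝ → CovariantDerivative I E (TangentSpace I : M → Type _)} {t : ℝ}

omit [FiniteDimensional ℝ E] [CompleteSpace E] [I.Boundaryless] in
/-- A family member read in the chart is the constant family of that member read in the chart.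
[folklore] -/
theorem chartRep_eq_const (g : ℝ → PseudoRiemannianMetric I ∞ E (TangentSpace I : M → Type _))
    (z : M) (t : ℝ) : chartRep I g z t = chartRep I (fun _ ↦ g t) z 0 := rfl

omit [CompleteSpace E] in
/-- The chart representative of a family member is a metric on the chart target. [folklore] -/
theorem isMetricOn_chartRep (g : ℝ → PseudoRiemannianMetric I ∞ E (TangentSpace I : M → Type _))
    (z : M) (t : ℝ) : IsMetricOn (chartRep I g z t) (extChartAt I z).target := by
  rw [chartRep_eq_const]
  exact isMetricOn_chartRep_const (g t) z

/-- **Chart independence of `U_k`**: for `z` in the source of the preferred chart at `z₀` and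
`g t` Riemannian, `U_k(t, z)` equals the same expression computed from the representative in the
chart at `z₀`, at the chart image of `z` (the representatives differ by the pull-back along the
transition map, `chartRep_eq_pullMetric_trans`, under which `|∇^k Rm|²` is invariant,
`tnormSq_curvD_pullMetric`, and the component calculus is local, `tnormSq_curvD_congr_of_eqOn`).
[cite: Topping2006, §3.3, Thm. 3.3.1] -/
theorem curvDerivNormSq_eq_chart (hR : (g t).IsRiemannian) {z z₀ : M}
    (hz : z ∈ (extChartAt I z₀).source) (k : ℕ) :
    curvDerivNormSq I g k t z = tnormSq (chartRep I g z₀ t) (finBasis ℝ E)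
      (curvD (chartRep I g z₀) (finBasis ℝ E) k t) (extChartAt I z₀ z) := by
  set τ : E → E := extChartAt I z₀ ∘ (extChartAt I z).symm with hτdef
  have hy : extChartAt I z z ∈ transSource I z z₀ := extChartAt_mem_transSource (mem_extChartAt_source z) hz
  have hτy : τ (extChartAt I z z) = extChartAt I z₀ z := by
    simp only [hτdef, Function.comp_apply, extChartAt_to_inv]
  have h1 : curvDerivNormSq I g k t z = tnormSq (pullMetric (chartRep I g z₀ t) τ) (finBasis ℝ E)
      (curvD (fun s ↦ pullMetric (chartRep I g z₀ s) τ) (finBasis ℝ E) k t) (extChartAt I z z) :=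
    tnormSq_curvD_congr_of_eqOn (isOpen_transSource z z₀)
      (fun s y hy' ↦ chartRep_eq_pullMetric_trans g s hy') t k hy
  have hpos : ∀ v, v ≠ 0 → 0 < chartRep I g z₀ t (τ (extChartAt I z z)) v v := fun v hv ↦ by
    rw [hτy]
    exact chartRep_pos hR z₀ ⟨extChartAt I z₀ z, (extChartAt I z₀).map_source hz⟩ v hv
  rw [h1, tnormSq_curvD_pullMetric (isMetricOn_chartRep g z₀ t) (isCoordChangeOn_trans z z₀) hy hpos k]
  exact congrArg _ hτy

/-- **`U_0 = |Rm|²`** (`curvNormSqWith`) for a metric with its Levi-Civita connection.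
[cite: Topping2006, §3.3] -/
theorem curvDerivNormSq_zero_eq (hR : (g t).IsRiemannian) (hLC : (g t).IsLeviCivita (cov t)) (z : M) :
    curvDerivNormSq I g 0 t z = (g t).curvNormSqWith (cov t) z := by
  have hu₀ : extChartAt I z z ∈ (extChartAt I z).target := mem_extChartAt_target z
  have hpos : ∀ v, v ≠ 0 → 0 < chartRep I g z t (extChartAt I z z) v v := fun v hv ↦
    chartRep_pos hR z ⟨extChartAt I z z, hu₀⟩ v hv
  rw [curvDerivNormSq, curvD, (isMetricOn_chartRep g z t).tnormSq_rm4_eq_rmNormSqAt (finBasis ℝ E) hu₀ hpos]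
  have h := curvNormSqWith_chartInv_eq' hLC z ⟨extChartAt I z z, hu₀⟩
  rw [show chartInv I z ⟨extChartAt I z z, hu₀⟩ = z from extChartAt_to_inv z] at h
  rw [h]
  rfl


/-- **`U_k(t, ·)` is `C^∞` on `M`** for `g t` Riemannian (in the chart at a point it is the smooth
coordinate function `|∇^k Rm|²` of the components). [cite: Topping2006, §1.2.3] -/
theorem contMDiffAt_curvDerivNormSq (hR : (g t).IsRiemannian) (k : ℕ) (x₀ : M) :
    CMDiffAt ∞ (curvDerivNormSq I g k t) x₀ := by
  have hGm := isMetricOn_chartRep g x₀ t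
  have hΦs : ContDiffOn ℝ ∞ (tnormSq (chartRep I g x₀ t) (finBasis ℝ E)
      (curvD (chartRep I g x₀) (finBasis ℝ E) k t)) (extChartAt I x₀).target :=
    hGm.contDiffOn_tnormSq (hGm.tsmoothOn_curvD k)
  have hΦ : CMDiff[(chartAt H x₀).source] ∞ (extChartAt I x₀) := contMDiffOn_extChartAt
  have hmaps : MapsTo (extChartAt I x₀) (chartAt H x₀).source (extChartAt I x₀).target := by
    intro y hy
    exact (extChartAt I x₀).map_source (by rw [extChartAt_source]; exact hy)
  have hcomp := (contMDiffOn_iff_contDiffOn.2 hΦs).comp hΦ hmaps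
  have heq : ∀ y ∈ (chartAt H x₀).source, curvDerivNormSq I g k t y =
      (tnormSq (chartRep I g x₀ t) (finBasis ℝ E) (curvD (chartRep I g x₀) (finBasis ℝ E) k t) ∘
        extChartAt I x₀) y := fun y hy ↦
    curvDerivNormSq_eq_chart hR (by rw [extChartAt_source]; exact hy) k
  exact ((hcomp.congr heq) x₀ (mem_chart_source H x₀)).contMDiffAt
    ((chartAt H x₀).open_source.mem_nhds (mem_chart_source H x₀))

/-- **Joint smoothness of `(z, t) ↦ U_k(t, z)` on `M × S`** for a family whose chart
representatives are smooth metric families on `(chart target) × S` and whose members are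
Riemannian. [cite: Topping2006, §1.2.3] -/
theorem contMDiffOn_curvDerivNormSq {S : Set ℝ}
    (hfam : ∀ z : M, IsMetricFamilyOn (chartRep I g z) S (extChartAt I z).target)
    (hR : ∀ s ∈ S, (g s).IsRiemannian) (k : ℕ) :
    ContMDiffOn (I.prod 𝓘(ℝ, ℝ)) 𝓘(ℝ, ℝ) ∞
      (fun p : M × ℝ ↦ curvDerivNormSq I g k p.2 p.1) (univ ×ˢ S) := by
  intro p hp
  obtain ⟨x, t⟩ := p
  have ht : t ∈ S := hp.2
  set z := x
  have hfam' : ContDiffOn ℝ ∞ (fun q : E × ℝ ↦ tnormSq (chartRep I g z q.2) (finBasis ℝ E)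
      (curvD (chartRep I g z) (finBasis ℝ E) k q.2) q.1) ((extChartAt I z).target ×ˢ S) :=
    (hfam z).contDiffOn_tnormSq_family (finBasis ℝ E) ((hfam z).tsmoothFamOn_curvD (finBasis ℝ E) k)
  have hΦ : ContMDiffOn (I.prod 𝓘(ℝ, ℝ)) 𝓘(ℝ, E × ℝ) ∞ (fun p : M × ℝ ↦ (extChartAt I z p.1, p.2))
      ((chartAt H z).source ×ˢ S) :=
    ((contMDiffOn_extChartAt (x := z)).comp contMDiffOn_fst fun p hp ↦ hp.1).prodMk_space
      contMDiffOn_snd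
  have hmaps : MapsTo (fun p : M × ℝ ↦ (extChartAt I z p.1, p.2)) ((chartAt H z).source ×ˢ S)
      ((extChartAt I z).target ×ˢ S) := by
    intro p hp
    refine ⟨(extChartAt I z).map_source ?_, hp.2⟩
    rw [extChartAt_source]
    exact hp.1
  have hcomp := (contMDiffOn_iff_contDiffOn.2 hfam').comp hΦ hmaps
  have hnhds : (chartAt H z).source ×ˢ S ∈ 𝓝[univ ×ˢ S] ((x, t) : M × ℝ) := by
    refine mem_nhdsWithin.mpr ⟨(chartAt H z).source ×ˢ univ,
      (chartAt H z).open_source.prod isOpen_univ, ⟨mem_chart_source H z, mem_univ _⟩, ?_⟩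
    rintro q ⟨⟨hq1, -⟩, ⟨-, hq2⟩⟩
    exact ⟨hq1, hq2⟩
  have hxz : (x, t) ∈ (chartAt H z).source ×ˢ S := ⟨mem_chart_source H z, ht⟩
  refine ((hcomp.congr fun q hq ↦ ?_) (x, t) hxz).mono_of_mem_nhdsWithin hnhds
  have hq1 : q.1 ∈ (extChartAt I z).source := by rw [extChartAt_source]; exact hq.1
  exact curvDerivNormSq_eq_chart (hR q.2 hq.2) hq1 k

omit [CompleteSpace E] in
/-- `U_k ≥ 0` for a Riemannian member. [folklore] -/
theorem curvDerivNormSq_nonneg (hR : (g t).IsRiemannian) (k : ℕ) (z : M) :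
    0 ≤ curvDerivNormSq I g k t z :=
  tnormSq_nonneg (finBasis ℝ E) ((isMetricOn_chartRep g z t).symm _ (mem_extChartAt_target z))
    (fun v hv ↦ chartRep_pos hR z ⟨extChartAt I z z, mem_extChartAt_target z⟩ v hv) _

/-! ### Along a Ricci flow -/

variable {S : Set ℝ}

/-- The chart components of a Ricci flow on a time set `S` of unique differentiability contained
in the closure of its interior form a smooth metric family (`IsMetricFamilyOn`; the cases
`S = [0, T]`, `[a, b]` are `isMetricFamilyOn_chartRep(_Icc)`). [cite: Topping2006, §1.2.3] -/
theorem IsRicciFlow.isMetricFamilyOn_chartRep_of (hflow : IsRicciFlow g cov S)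
    (hS : UniqueDiffOn ℝ S) (hS' : S ⊆ closure (interior S)) (x₀ : M) :
    IsMetricFamilyOn (chartRep I g x₀) S (extChartAt I x₀).target where
  isMetricOn t _ := Lorentzian.OpensChart.isMetricOn_repr (val_chartPullback_eq_chartRep g x₀ t)
  contDiffOn := contDiffOn_chartRep hflow.smooth x₀
  uniqueDiffOn := hS
  subset_closure_interior := hS'

/-- **The Ricci flow equation in the chart** on a general time set (cf. `tDeriv_chartRep_eq`):
`∂G/∂t = −2 Ric(G)` on `(chart target) × S`. [cite: Topping2006, (1.1.1)] -/
theorem IsRicciFlow.tDeriv_chartRep_eq_of (hflow : IsRicciFlow g cov S) (hS : UniqueDiffOn ℝ S)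
    (hS' : S ⊆ closure (interior S)) (x₀ : M) {s : ℝ} (hs : s ∈ S) {y : E}
    (hy : y ∈ (extChartAt I x₀).target) :
    tDeriv (chartRep I g x₀) S s y = (-2 : ℝ) • ricAt (chartRep I g x₀ s) y := by
  have hfam := hflow.isMetricFamilyOn_chartRep_of hS hS' x₀
  haveI := (g s).hasLeviCivita
  haveI := (chartPullback I (g s) x₀).hasLeviCivita
  have h2 : (2 : ℕ∞ω) ≤ ∞ := WithTop.coe_le_coe.mpr le_top
  set u : chartTarget I x₀ := ⟨y, hy⟩ with hu
  ext v w
  have hd := (hfam.hasDerivWithinAt_apply₂ hy hs v w).derivWithin (hS s hs)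
  have hflowd := (hflow.hasDerivWithinAt s hs ((extChartAt I x₀).symm y)
    ((trivializationAt E (TangentSpace I : M → Type _) x₀).symmL ℝ ((extChartAt I x₀).symm y) v)
    ((trivializationAt E (TangentSpace I : M → Type _) x₀).symmL ℝ ((extChartAt I x₀).symm y) w)).derivWithin
    (hS s hs)
  change derivWithin (fun s' ↦ (g s').val ((extChartAt I x₀).symm y)
      ((trivializationAt E (TangentSpace I : M → Type _) x₀).symmL ℝ ((extChartAt I x₀).symm y) v)
      ((trivializationAt E (TangentSpace I : M → Type _) x₀).symmL ℝ ((extChartAt I x₀).symm y) w))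
    S s = _ at hd
  rw [hflowd] at hd
  rw [← hd, _root_.smul_apply, _root_.smul_apply, smul_eq_mul,
    (hflow.isLeviCivita s hs).ricci_eq_ricci h2,
    ← Lorentzian.OpensChart.ricci_eq_ricAt (val_chartPullback_eq_chartRep g x₀ s) u v w,
    (g s).ricci_comap_apply contMDiff_pullbackBilin_holds (contMDiff_chartInv x₀)
      (injective_mfderiv_chartInv x₀) rfl u v w,
    mfderiv_chartInv_eq_symmL x₀ u v, mfderiv_chartInv_eq_symmL x₀ u w]
  rfl

/-- **Joint smoothness of `U_k` along a Ricci flow of Riemannian metrics.**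
[cite: Topping2006, §1.2.3] -/
theorem IsRicciFlow.contMDiffOn_curvDerivNormSq (hflow : IsRicciFlow g cov S)
    (hS : UniqueDiffOn ℝ S) (hS' : S ⊆ closure (interior S)) (hR : ∀ s ∈ S, (g s).IsRiemannian)
    (k : ℕ) :
    ContMDiffOn (I.prod 𝓘(ℝ, ℝ)) 𝓘(ℝ, ℝ) ∞
      (fun p : M × ℝ ↦ curvDerivNormSq I g k p.2 p.1) (univ ×ˢ S) :=
  Riemannian.contMDiffOn_curvDerivNormSq (fun z ↦ hflow.isMetricFamilyOn_chartRep_of hS hS' z) hR k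

omit [FiniteDimensional ℝ E] [CompleteSpace E] [I.Boundaryless] [IsManifold I ∞ M] in
/-- The time slices of a jointly smooth function on `M × S` are differentiable within `S`
(cf. `hasDerivWithinAt_time` for `S = [0, T]`). [folklore] -/
theorem hasDerivWithinAt_time_of {u : ℝ → M → ℝ}
    (hu : ContMDiffOn (I.prod 𝓘(ℝ, ℝ)) 𝓘(ℝ, ℝ) ∞ (fun p : M × ℝ ↦ u p.2 p.1) (univ ×ˢ S))
    (x : M) (ht : t ∈ S) :
    HasDerivWithinAt (fun s ↦ u s x) (derivWithin (fun s ↦ u s x) S t) S t := by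
  have hι : ContMDiff 𝓘(ℝ, ℝ) (I.prod 𝓘(ℝ, ℝ)) ∞ (fun s : ℝ ↦ (x, s)) :=
    contMDiff_const.prodMk contMDiff_id
  have hcomp : ContMDiffOn 𝓘(ℝ, ℝ) 𝓘(ℝ, ℝ) ∞ (fun s ↦ u s x) S :=
    hu.comp hι.contMDiffOn fun s hs ↦ ⟨mem_univ _, hs⟩
  rw [contMDiffOn_iff_contDiffOn] at hcomp
  exact ((hcomp.differentiableOn (by simp)) t ht).hasDerivWithinAt

/-- **The time derivative of `U_k` exists within `S`** (from joint smoothness). [folklore] -/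
theorem IsRicciFlow.hasDerivWithinAt_curvDerivNormSq (hflow : IsRicciFlow g cov S)
    (hS : UniqueDiffOn ℝ S) (hS' : S ⊆ closure (interior S)) (hR : ∀ s ∈ S, (g s).IsRiemannian)
    (k : ℕ) (z : M) (ht : t ∈ S) :
    HasDerivWithinAt (fun s ↦ curvDerivNormSq I g k s z)
      (derivWithin (fun s ↦ curvDerivNormSq I g k s z) S t) S t :=
  hasDerivWithinAt_time_of (u := fun s z ↦ curvDerivNormSq I g k s z)
    (hflow.contMDiffOn_curvDerivNormSq hS hS' hR k) z ht

/-- **The evolution inequality for `U_k` along a Ricci flow, in one chart** (Topping 2006,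
(3.3.4) for all `k`): for a Ricci flow of Riemannian metrics on a time set `S` (of unique
differentiability, inside the closure of its interior, containing `t₀`) and a point `z₀`, there
is `C ≥ 0` with
`∂_t U_k ≤ Δ_{g(t)} U_k − 2 U_{k+1} + C (Σ_{p ≤ k} √U_p √U_{k−p}) √U_k + C √U_0 U_k`
at every `t ∈ S` and every `z` in the source of the chart at `z₀` (`∂_t` within `S`,
`Δ = laplaceBeltrami`): the coordinate inequality `derivWithin_tnormSq_curvD_le` in the chart at
`z₀`, transported by `curvDerivNormSq_eq_chart` and `dalembertian_comap`.
[cite: Topping2006, §3.3, (3.3.4)] -/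
theorem IsRicciFlow.derivWithin_curvDerivNormSq_le_chart (hflow : IsRicciFlow g cov S)
    (hS : UniqueDiffOn ℝ S) (hS' : S ⊆ closure (interior S)) (hR : ∀ s ∈ S, (g s).IsRiemannian)
    {t₀ : ℝ} (ht₀ : t₀ ∈ S) (z₀ : M) (k : ℕ) :
    ∃ C : ℝ, 0 ≤ C ∧ ∀ t ∈ S, ∀ z ∈ (extChartAt I z₀).source,
      derivWithin (fun s ↦ curvDerivNormSq I g k s z) S t ≤
        (g t).laplaceBeltrami (curvDerivNormSq I g k t) z - 2 * curvDerivNormSq I g (k + 1) t z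
        + C * (∑ p ∈ Finset.range (k + 1), Real.sqrt (curvDerivNormSq I g p t z) *
            Real.sqrt (curvDerivNormSq I g (k - p) t z)) * Real.sqrt (curvDerivNormSq I g k t z)
        + C * Real.sqrt (curvDerivNormSq I g 0 t z) * curvDerivNormSq I g k t z := by
  have hfam := hflow.isMetricFamilyOn_chartRep_of hS hS' z₀
  have hfl : ∀ s ∈ S, ∀ y ∈ (extChartAt I z₀).target,
      tDeriv (chartRep I g z₀) S s y = (-2 : ℝ) • ricAt (chartRep I g z₀ s) y :=
    fun s hs y hy ↦ hflow.tDeriv_chartRep_eq_of hS hS' z₀ hs hy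
  obtain ⟨C, hC0, hC⟩ := hfam.derivWithin_tnormSq_curvD_le (finBasis ℝ E) hfl ht₀ k
  refine ⟨C, hC0, fun t ht z hz ↦ ?_⟩
  set G := chartRep I g z₀ with hGdef
  set b := finBasis ℝ E with hbdef
  have hy : extChartAt I z₀ z ∈ (extChartAt I z₀).target := (extChartAt I z₀).map_source hz
  set u : chartTarget I z₀ := ⟨extChartAt I z₀ z, hy⟩ with hudef
  have hΦu : chartInv I z₀ u = z := (extChartAt I z₀).left_inv hz
  have hpos : ∀ v : E, v ≠ 0 → 0 < G t u v v := fun v hv ↦ chartRep_pos (hR t ht) z₀ u v hv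
  have key := hC t ht u hy hpos
  -- transport of the functions
  have hfun : ∀ j, ∀ s ∈ S, curvDerivNormSq I g j s z = tnormSq (G s) b (curvD G b j s) u :=
    fun j s hs ↦ curvDerivNormSq_eq_chart (hR s hs) hz j
  have hderiv : derivWithin (fun s ↦ curvDerivNormSq I g k s z) S t =
      derivWithin (fun s ↦ tnormSq (G s) b (curvD G b k s) u) S t :=
    derivWithin_congr (fun s hs ↦ hfun k s hs) (hfun k t ht)
  -- transport of the Laplacian
  haveI := (g t).hasLeviCivita
  haveI := (chartPullback I (g t) z₀).hasLeviCivita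
  have h2 : (2 : ℕ∞ω) ≤ ∞ := WithTop.coe_le_coe.mpr le_top
  have hGv := val_chartPullback_eq_chartRep g z₀ t
  have hfsmooth : CMDiffAt 2 (curvDerivNormSq I g k t) (chartInv I z₀ u) :=
    (contMDiffAt_curvDerivNormSq (hR t ht) k _).of_le h2
  have hrep : ∀ u' : chartTarget I z₀, (curvDerivNormSq I g k t ∘ chartInv I z₀) u' =
      tnormSq (G t) b (curvD G b k t) u' := by
    intro u'
    have h := curvDerivNormSq_eq_chart (hR t ht) (z := chartInv I z₀ u') (z₀ := z₀)
      (by rw [extChartAt_source]; exact chartInv_mem_source z₀ u') k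
    rw [extChartAt_chartInv] at h
    exact h
  have hΦc : ContDiffAt ℝ 2 (tnormSq (G t) b (curvD G b k t)) (u : E) :=
    (((hfam.isMetricOn t ht).contDiffOn_tnormSq ((hfam.isMetricOn t ht).tsmoothOn_curvD k)).contDiffAt
      ((isOpen_extChartAt_target z₀).mem_nhds hy)).of_le h2
  have hlap : lapAt (G t) (tnormSq (G t) b (curvD G b k t)) u =
      (g t).laplaceBeltrami (curvDerivNormSq I g k t) z := by
    rw [← Lorentzian.OpensChart.dalembertian_eq_lapAt hGv u hrep hΦc,
      (g t).dalembertian_comap contMDiff_pullbackBilin_holds (contMDiff_chartInv z₀)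
        (injective_mfderiv_chartInv z₀) rfl hfsmooth,
      hΦu, laplaceBeltrami_eq_dalembertian]
  have hfun' : ∀ j, curvDerivNormSq I g j t z = tnormSq (G t) b (curvD G b j t) u := fun j ↦ hfun j t ht
  rw [hderiv, ← hlap]
  simp only [hfun']
  exact key

/-- **The evolution inequality for `U_k` along a Ricci flow on a closed manifold** (Topping 2006,
(3.3.4) for all `k`; Hamilton 1982, §13): one constant `C ≥ 0` for all `(t, z) ∈ S × M`
(finitely many charts cover `M`). [cite: Topping2006, §3.3, (3.3.4)] -/
theorem IsRicciFlow.derivWithin_curvDerivNormSq_le [CompactSpace M] (hflow : IsRicciFlow g cov S)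
    (hS : UniqueDiffOn ℝ S) (hS' : S ⊆ closure (interior S)) (hR : ∀ s ∈ S, (g s).IsRiemannian)
    {t₀ : ℝ} (ht₀ : t₀ ∈ S) (k : ℕ) :
    ∃ C : ℝ, 0 ≤ C ∧ ∀ t ∈ S, ∀ z : M,
      derivWithin (fun s ↦ curvDerivNormSq I g k s z) S t ≤
        (g t).laplaceBeltrami (curvDerivNormSq I g k t) z - 2 * curvDerivNormSq I g (k + 1) t z
        + C * (∑ p ∈ Finset.range (k + 1), Real.sqrt (curvDerivNormSq I g p t z) *
            Real.sqrt (curvDerivNormSq I g (k - p) t z)) * Real.sqrt (curvDerivNormSq I g k t z)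
        + C * Real.sqrt (curvDerivNormSq I g 0 t z) * curvDerivNormSq I g k t z := by
  choose C hC0 hC using fun z₀ : M ↦ hflow.derivWithin_curvDerivNormSq_le_chart hS hS' hR ht₀ z₀ k
  obtain ⟨F, hcover⟩ := isCompact_univ.elim_finite_subcover (fun z₀ : M ↦ (extChartAt I z₀).source)
    (fun z₀ ↦ isOpen_extChartAt_source z₀) fun z _ ↦ mem_iUnion.2 ⟨z, mem_extChartAt_source z⟩
  refine ⟨∑ z₀ ∈ F, C z₀, Finset.sum_nonneg fun z₀ _ ↦ hC0 z₀, fun t ht z ↦ ?_⟩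
  obtain ⟨z₀, hz₀F, hz⟩ : ∃ z₀ ∈ F, z ∈ (extChartAt I z₀).source := by
    simpa only [mem_iUnion, exists_prop] using hcover (mem_univ z)
  have hle : C z₀ ≤ ∑ z₁ ∈ F, C z₁ := Finset.single_le_sum (fun z₁ _ ↦ hC0 z₁) hz₀F
  have h := hC z₀ t ht z hz
  have hA : 0 ≤ (∑ p ∈ Finset.range (k + 1), Real.sqrt (curvDerivNormSq I g p t z) *
      Real.sqrt (curvDerivNormSq I g (k - p) t z)) * Real.sqrt (curvDerivNormSq I g k t z) :=
    mul_nonneg (Finset.sum_nonneg fun p _ ↦ mul_nonneg (Real.sqrt_nonneg _) (Real.sqrt_nonneg _))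
      (Real.sqrt_nonneg _)
  have hB : 0 ≤ Real.sqrt (curvDerivNormSq I g 0 t z) * curvDerivNormSq I g k t z :=
    mul_nonneg (Real.sqrt_nonneg _) (curvDerivNormSq_nonneg (hR t ht) k z)
  nlinarith [mul_le_mul_of_nonneg_right hle hA, mul_le_mul_of_nonneg_right hle hB]

end Global

end Literature.Geometry.Riemannian

end
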